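import Mathlib
import Literature.MathematicalPhysics.QuantumLattice.LatticeScalarField
import Literature.Probability.LatticeModels.ThermodynamicLimit
import Summits.QuantumFields.YangMills.Theorems.ScalingWindowSplitSelfNormalisedSkewnessStubFlatNearDisjointSupports
import HarnessLib

/-!
# Crux `SelfNormalisedSkewness` (stmt-QuantumFields-18944), line `Sketch`:
# stub `stub_flatPairSum` (flat pair sums of disjointly supported Schwartz functions)

For Schwartz `f, g` on `ℝ⁴` with disjoint topological supports, the lattice pair sum
`∑_{x ≠ y ∈ {-L..L}⁴} |f(ax)| |g(ay)| D(x,y)⁻⁹`, where `D` is the distance on the discrete torus of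
side `2L+1`, is `O(a)` uniformly in `0 < a ≤ 1 ≤ a²L`.

Proof. Pointwise, `|f(ax)| |g(ay)| D⁻⁹ ≤ K a⁹ (1 + ‖ax‖)⁻⁸ (1 + ‖ay‖)⁻⁸` (`pair_term_le`): if no
coordinate of `x - y` exceeds `L` in absolute value then `D ≥ ‖x - y‖` (the `ZMod` representative of
minimal absolute value) and the flatness of `f` at points where `g ≠ 0`
(`stub_flatNearDisjointSupports`, `N = 9`, `M = 8`) gives the bound; otherwise `D⁻¹ ≤ 1` while
`‖ax‖ + ‖ay‖ ≥ aL ≥ 1/a`, and the Schwartz decay `(1 + ‖·‖)⁻¹⁷` of both factors gives it. Summing,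
`∑_{x ∈ box} (1 + ‖ax‖)⁻⁸ ≤ (∑_{|n| ≤ L} (1 + a|n|)⁻²)⁴ ≤ (4/a)⁴` by a telescoping bound. Folklore.
-/

noncomputable section

open scoped BigOperators
open Literature.Probability.LatticeModels (Site Torus.proj box mem_box)
open Literature.MathematicalPhysics.QuantumLattice (siteToE siteToE_apply)

namespace Summit.QuantumFields.YangMills.Theorems.SelfNormalisedSkewness.Negative

/-- Telescoping bound `∑_{k<N} (1 + a(k+1))⁻² ≤ 1/a` for `a > 0`. [folklore] -/
theorem sum_range_inv_sq_le {a : ℝ} (ha : 0 < a) (N : ℕ) :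
    ∑ k ∈ Finset.range N, ((1 + a * ((k : ℝ) + 1)) ^ 2)⁻¹ ≤ a⁻¹ := by
  set u : ℕ → ℝ := fun k => (a * (1 + a * k))⁻¹ with hu
  have key : ∀ k : ℕ, ((1 + a * ((k : ℝ) + 1)) ^ 2)⁻¹ ≤ u k - u (k + 1) := by
    intro k
    have h1 : (0 : ℝ) < 1 + a * k := by positivity
    have h2 : (0 : ℝ) < 1 + a * ((k : ℝ) + 1) := by positivity
    have ha' : a ≠ 0 := ha.ne'
    have hk : u k - u (k + 1) = ((1 + a * k) * (1 + a * ((k : ℝ) + 1)))⁻¹ := by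
      simp only [hu, Nat.cast_add, Nat.cast_one]
      have h1' := h1.ne'
      have h2' := h2.ne'
      field_simp
      ring
    rw [hk]
    apply inv_anti₀ (by positivity)
    rw [sq]
    exact mul_le_mul_of_nonneg_right (by nlinarith) h2.le
  calc ∑ k ∈ Finset.range N, ((1 + a * ((k : ℝ) + 1)) ^ 2)⁻¹
      ≤ ∑ k ∈ Finset.range N, (u k - u (k + 1)) := Finset.sum_le_sum fun k _ => key k
    _ = u 0 - u N := Finset.sum_range_sub' u N
    _ ≤ u 0 := sub_le_self _ (by positivity)
    _ = a⁻¹ := by simp [hu]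

/-- `∑_{k ≤ L} (1 + a k)⁻² ≤ 2/a` for `0 < a ≤ 1`. [folklore] -/
theorem sum_range_succ_inv_sq_le {a : ℝ} (ha : 0 < a) (ha1 : a ≤ 1) (L : ℕ) :
    ∑ k ∈ Finset.range (L + 1), ((1 + a * (k : ℝ)) ^ 2)⁻¹ ≤ 2 * a⁻¹ := by
  rw [Finset.sum_range_succ']
  have h1 : (1 : ℝ) ≤ a⁻¹ := (one_le_inv₀ ha).mpr ha1
  have h2 := sum_range_inv_sq_le ha L
  push_cast
  simp only [mul_zero, add_zero, one_pow, inv_one]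
  linarith

/-- `∑_{|n| ≤ L} (1 + a|n|)⁻² ≤ 4/a` for `0 < a ≤ 1` (fold `ℤ` onto `ℕ` twice). [folklore] -/
theorem sum_Icc_inv_sq_le {a : ℝ} (ha : 0 < a) (ha1 : a ≤ 1) (L : ℕ) :
    ∑ n ∈ Finset.Icc (-(L : ℤ)) L, ((1 + a * |(n : ℝ)|) ^ 2)⁻¹ ≤ 4 * a⁻¹ := by
  set φ : ℤ → ℝ := fun n => ((1 + a * |(n : ℝ)|) ^ 2)⁻¹ with hφ
  have hφnn : ∀ n, 0 ≤ φ n := fun n => by positivity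
  set s : Finset ℤ := (Finset.range (L + 1)).image (fun k : ℕ => (k : ℤ)) with hs
  set t : Finset ℤ := (Finset.range (L + 1)).image (fun k : ℕ => -(k : ℤ)) with ht
  have hsub : Finset.Icc (-(L : ℤ)) L ⊆ s ∪ t := by
    intro n hn
    rw [Finset.mem_Icc] at hn
    rw [Finset.mem_union, hs, ht, Finset.mem_image, Finset.mem_image]
    rcases Int.eq_nat_or_neg n with ⟨k, rfl | rfl⟩
    · exact Or.inl ⟨k, Finset.mem_range.mpr (by omega), rfl⟩
    · exact Or.inr ⟨k, Finset.mem_range.mpr (by omega), rfl⟩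
  have hbase := sum_range_succ_inv_sq_le ha ha1 L
  have h1 : ∑ n ∈ s, φ n ≤ 2 * a⁻¹ := by
    rw [hs, Finset.sum_image fun x _ y _ h => by exact_mod_cast h]
    simpa [hφ] using hbase
  have h2 : ∑ n ∈ t, φ n ≤ 2 * a⁻¹ := by
    rw [ht, Finset.sum_image fun x _ y _ h => by exact_mod_cast (neg_inj.mp h)]
    simpa [hφ] using hbase
  calc ∑ n ∈ Finset.Icc (-(L : ℤ)) L, φ n ≤ ∑ n ∈ s ∪ t, φ n :=
        Finset.sum_le_sum_of_subset_of_nonneg hsub fun n _ _ => hφnn n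
    _ ≤ ∑ n ∈ s, φ n + ∑ n ∈ t, φ n := by
        rw [← Finset.sum_union_inter]
        linarith [Finset.sum_nonneg fun n (_ : n ∈ s ∩ t) => hφnn n]
    _ ≤ 4 * a⁻¹ := by linarith

/-- Lattice Riemann sum in `ℤ⁴`: `∑_{x ∈ box 4 L} (1 + ‖a x‖)⁻⁸ ≤ 256 a⁻⁴` for `0 < a ≤ 1`,
by comparison with the product weight `∏ᵢ (1 + a|xᵢ|)⁻²`. [folklore] -/
theorem sum_box_weight_le {a : ℝ} (ha : 0 < a) (ha1 : a ≤ 1) (L : ℕ) :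
    ∑ x ∈ box 4 L, ((1 + ‖a • siteToE x‖) ^ 8)⁻¹ ≤ 256 * a⁻¹ ^ 4 := by
  have hpt : ∀ x : Site 4,
      ((1 + ‖a • siteToE x‖) ^ 8)⁻¹ ≤ ∏ i, ((1 + a * |(x i : ℝ)|) ^ 2)⁻¹ := by
    intro x
    rw [Finset.prod_inv_distrib]
    apply inv_anti₀ (by positivity)
    calc ∏ i, (1 + a * |(x i : ℝ)|) ^ 2 ≤ ∏ _i : Fin 4, (1 + ‖a • siteToE x‖) ^ 2 := by
          apply Finset.prod_le_prod (fun i _ => by positivity)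
          intro i _
          apply pow_le_pow_left₀ (by positivity)
          have h := PiLp.norm_apply_le (a • siteToE x) i
          simp only [PiLp.smul_apply, siteToE_apply, smul_eq_mul, Real.norm_eq_abs, abs_mul,
            abs_of_pos ha] at h
          linarith
      _ = (1 + ‖a • siteToE x‖) ^ 8 := by
          rw [Finset.prod_const, Finset.card_univ, Fintype.card_fin, ← pow_mul]
  calc ∑ x ∈ box 4 L, ((1 + ‖a • siteToE x‖) ^ 8)⁻¹
      ≤ ∑ x ∈ box 4 L, ∏ i, ((1 + a * |(x i : ℝ)|) ^ 2)⁻¹ := Finset.sum_le_sum fun x _ => hpt x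
    _ = (∑ n ∈ Finset.Icc (-(L : ℤ)) L, ((1 + a * |(n : ℝ)|) ^ 2)⁻¹) ^ 4 := by
        rw [Finset.sum_pow']; rfl
    _ ≤ (4 * a⁻¹) ^ 4 :=
        pow_le_pow_left₀ (Finset.sum_nonneg fun n _ => by positivity) (sum_Icc_inv_sq_le ha ha1 L) 4
    _ = 256 * a⁻¹ ^ 4 := by ring

/-- If `D² ∈ ℕ` then `D⁻¹ ≤ 1` (with the convention `0⁻¹ = 0`). [folklore] -/
theorem inv_sqrt_sum_sq_int_le_one {ι : Type*} (s : Finset ι) (z : ι → ℤ) :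
    (Real.sqrt (∑ i ∈ s, ((z i : ℤ) : ℝ) ^ 2))⁻¹ ≤ 1 := by
  have hcast : (∑ i ∈ s, ((z i : ℤ) : ℝ) ^ 2) = ((∑ i ∈ s, z i ^ 2 : ℤ) : ℝ) := by push_cast; rfl
  have hnn : 0 ≤ ∑ i ∈ s, z i ^ 2 := Finset.sum_nonneg fun i _ => sq_nonneg _
  rcases (show (∑ i ∈ s, z i ^ 2) = 0 ∨ 1 ≤ ∑ i ∈ s, z i ^ 2 by omega) with h | h
  · rw [hcast, h]; simp
  · rw [hcast]
    apply inv_le_one_of_one_le₀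
    rw [Real.one_le_sqrt]
    exact_mod_cast h

/-- Schwartz decay with the weight `(1 + ‖X‖)¹⁷`. [folklore] -/
theorem schwartz_abs_le_inv_pow (f : SchwartzMap (EuclideanSpace ℝ (Fin 4)) ℝ) :
    ∃ C : ℝ, 0 ≤ C ∧ ∀ X, |f X| ≤ C * ((1 + ‖X‖) ^ 17)⁻¹ := by
  obtain ⟨D, hD⟩ : ∃ D : ℝ, ∀ z : EuclideanSpace ℝ (Fin 4),
      (1 + ‖z‖) ^ 17 * ‖iteratedFDeriv ℝ 0 f z‖ ≤ D :=
    ⟨_, fun z =>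
      SchwartzMap.one_add_le_sup_seminorm_apply (𝕜 := ℝ) (m := (17, 0)) le_rfl le_rfl f z⟩
  have hD0 : 0 ≤ D := le_trans (by positivity) (hD 0)
  refine ⟨D, hD0, fun X => ?_⟩
  have h := hD X
  rw [norm_iteratedFDeriv_zero, Real.norm_eq_abs] at h
  have hpos : 0 < (1 + ‖X‖) ^ 17 := by positivity
  rw [← div_eq_mul_inv, le_div_iff₀ hpos]
  linarith [mul_comm ((1 + ‖X‖) ^ 17) |f X|]

/-- **Pointwise pair bound.** For `x ≠ y` in `ℤ⁴`, `0 < a ≤ 1` and `a²L ≥ 1`, the pair term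
`|f(ax)| |g(ay)| D⁻⁹` (torus distance `D` on the torus of side `2L+1`) is at most
`K a⁹ (1 + ‖ax‖)⁻⁸ (1 + ‖ay‖)⁻⁸`: without wrap-around `D = ‖x - y‖` and one uses the flatness of
`f` where `g ≠ 0`; with wrap-around `‖ax‖ + ‖ay‖ ≥ aL ≥ 1/a` and one uses Schwartz decay. [folklore] -/
theorem pair_term_le (f g : SchwartzMap (EuclideanSpace ℝ (Fin 4)) ℝ)
    (hfg : Disjoint (tsupport f) (tsupport g)) :
    ∃ K : ℝ, 0 ≤ K ∧ ∀ (a : ℝ), 0 < a → a ≤ 1 → ∀ (L : ℕ), (1 : ℝ) ≤ a ^ 2 * L →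
      ∀ x y : Site 4, x ≠ y →
        |f (a • siteToE x)| * |g (a • siteToE y)| *
          (Real.sqrt (∑ μ, ((((Torus.proj (2 * L + 1) x - Torus.proj (2 * L + 1) y) μ).valMinAbs
            : ℤ) : ℝ) ^ 2))⁻¹ ^ 9
        ≤ K * a ^ 9 * ((1 + ‖a • siteToE x‖) ^ 8)⁻¹ * ((1 + ‖a • siteToE y‖) ^ 8)⁻¹ := by
  obtain ⟨CE, hCE0, hCE⟩ := stub_flatNearDisjointSupports f g hfg 9 8
  obtain ⟨Cf, hCf0, hCf⟩ := schwartz_abs_le_inv_pow f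
  obtain ⟨Cg, hCg0, hCg⟩ := schwartz_abs_le_inv_pow g
  refine ⟨CE * Cg + Cf * Cg, by positivity, ?_⟩
  intro a ha ha1 L hL x y hxy
  set X := a • siteToE x with hX
  set Y := a • siteToE y with hY
  set D := Real.sqrt (∑ μ, ((((Torus.proj (2 * L + 1) x - Torus.proj (2 * L + 1) y) μ).valMinAbs
            : ℤ) : ℝ) ^ 2) with hD
  set wX := ((1 + ‖X‖) ^ 8)⁻¹ with hwX
  set wY := ((1 + ‖Y‖) ^ 8)⁻¹ with hwY
  have hwX0 : 0 < wX := by positivity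
  have hwY0 : 0 < wY := by positivity
  have hD0 : 0 ≤ D⁻¹ := inv_nonneg.mpr (Real.sqrt_nonneg _)
  have hgY : |g Y| ≤ Cg * wY := by
    refine (hCg Y).trans (mul_le_mul_of_nonneg_left ?_ hCg0)
    apply inv_anti₀ (by positivity)
    exact pow_le_pow_right₀ (by linarith [norm_nonneg Y]) (by norm_num)
  by_cases hwrap : ∃ i, L < (x i - y i).natAbs
  · -- wrap-around pairs: Schwartz decay of both factors
    obtain ⟨i, hi⟩ := hwrap
    have hD1 : D⁻¹ ^ 9 ≤ 1 := pow_le_one₀ hD0 (inv_sqrt_sum_sq_int_le_one _ _)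
    have hXi : a * |(x i : ℝ)| ≤ ‖X‖ := by
      have h := PiLp.norm_apply_le X i
      simp only [hX, PiLp.smul_apply, siteToE_apply, smul_eq_mul, Real.norm_eq_abs, abs_mul,
        abs_of_pos ha] at h
      exact h
    have hYi : a * |(y i : ℝ)| ≤ ‖Y‖ := by
      have h := PiLp.norm_apply_le Y i
      simp only [hY, PiLp.smul_apply, siteToE_apply, smul_eq_mul, Real.norm_eq_abs, abs_mul,
        abs_of_pos ha] at h
      exact h
    have hiR : (L : ℝ) < |(x i : ℝ) - (y i : ℝ)| := by
      have h1 : (L : ℤ) < ((x i - y i).natAbs : ℤ) := by exact_mod_cast hi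
      rw [Int.natCast_natAbs] at h1
      have h2 : ((L : ℤ) : ℝ) < ((|x i - y i| : ℤ) : ℝ) := Int.cast_lt.mpr h1
      push_cast at h2
      exact h2
    have habs : |(x i : ℝ) - (y i : ℝ)| ≤ |(x i : ℝ)| + |(y i : ℝ)| := abs_sub _ _
    set P := (1 + ‖X‖) * (1 + ‖Y‖) with hP
    have hP0 : 0 < P := by positivity
    have h3 : a * (L : ℝ) ≤ ‖X‖ + ‖Y‖ := by
      have h1 : a * (L : ℝ) ≤ a * (|(x i : ℝ)| + |(y i : ℝ)|) :=
        mul_le_mul_of_nonneg_left (by linarith) ha.le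
      have h2 : a * (|(x i : ℝ)| + |(y i : ℝ)|) = a * |(x i : ℝ)| + a * |(y i : ℝ)| := mul_add _ _ _
      linarith
    have h4 : ‖X‖ + ‖Y‖ ≤ P := by rw [hP]; nlinarith [norm_nonneg X, norm_nonneg Y]
    have haP : 1 ≤ a * P :=
      calc (1 : ℝ) ≤ a ^ 2 * L := hL
        _ = a * (a * L) := by ring
        _ ≤ a * (‖X‖ + ‖Y‖) := mul_le_mul_of_nonneg_left h3 ha.le
        _ ≤ a * P := mul_le_mul_of_nonneg_left h4 ha.le
    have hPinv : (P ^ 9)⁻¹ ≤ a ^ 9 := by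
      rw [← inv_pow]
      exact pow_le_pow_left₀ (inv_nonneg.mpr hP0.le) ((inv_le_iff_one_le_mul₀ hP0).mpr haP) 9
    calc |f X| * |g Y| * D⁻¹ ^ 9 ≤ |f X| * |g Y| * 1 :=
          mul_le_mul_of_nonneg_left hD1 (by positivity)
      _ ≤ (Cf * ((1 + ‖X‖) ^ 17)⁻¹) * (Cg * ((1 + ‖Y‖) ^ 17)⁻¹) := by
          rw [mul_one]; exact mul_le_mul (hCf X) (hCg Y) (abs_nonneg _) (by positivity)
      _ = Cf * Cg * (P ^ 9)⁻¹ * wX * wY := by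
          rw [hP, hwX, hwY]; generalize 1 + ‖X‖ = u; generalize 1 + ‖Y‖ = v; ring
      _ ≤ Cf * Cg * a ^ 9 * wX * wY := by gcongr
      _ ≤ (CE * Cg + Cf * Cg) * a ^ 9 * wX * wY := by
          gcongr; linarith [mul_nonneg hCE0 hCg0]
  · -- no wrap-around: the torus distance is the Euclidean one, use flatness of `f` near `g ≠ 0`
    push Not at hwrap
    by_cases hg0 : g Y = 0
    · rw [hg0, abs_zero, mul_zero, zero_mul]; positivity
    set E := ‖siteToE x - siteToE y‖ with hE
    have hE0 : 0 < E := by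
      rw [hE, norm_pos_iff, sub_ne_zero]
      intro h
      apply hxy
      funext i
      have := congrArg (fun v => v i) h
      simp only [siteToE_apply] at this
      exact_mod_cast this
    have hED : E ≤ D := by
      rw [hD, hE]
      apply Real.le_sqrt_of_sq_le
      rw [EuclideanSpace.real_norm_sq_eq]
      apply Finset.sum_le_sum
      intro μ _
      have hμ := hwrap μ
      have hmin := ZMod.natAbs_min_of_le_div_two (2 * L + 1) (x μ - y μ)
        (((x μ - y μ : ℤ) : ZMod (2 * L + 1)).valMinAbs) (by rw [ZMod.coe_valMinAbs]) (by omega)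
      rw [Int.natAbs_le_iff_sq_le] at hmin
      have hcast : ((x μ - y μ : ℤ) : ℝ) ^ 2 ≤
          ((((x μ - y μ : ℤ) : ZMod (2 * L + 1)).valMinAbs : ℤ) : ℝ) ^ 2 := by exact_mod_cast hmin
      have hproj : (Torus.proj (2 * L + 1) x - Torus.proj (2 * L + 1) y) μ =
          ((x μ - y μ : ℤ) : ZMod (2 * L + 1)) := by
        simp [Literature.Probability.LatticeModels.Torus.proj_apply]
      have hsite : (siteToE x - siteToE y) μ = ((x μ - y μ : ℤ) : ℝ) := by
        simp [siteToE_apply]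
      rw [hproj, hsite]
      exact hcast
    have hDE : D⁻¹ ^ 9 ≤ E⁻¹ ^ 9 := pow_le_pow_left₀ hD0 (inv_anti₀ hE0 hED) 9
    have hflat := hCE X Y hg0
    have hXY : ‖X - Y‖ = a * E := by
      rw [hX, hY, ← smul_sub, norm_smul, Real.norm_eq_abs, abs_of_pos ha]
    rw [hXY] at hflat
    have hfE : |f X| * E⁻¹ ^ 9 ≤ CE * a ^ 9 * wX := by
      have h1 : |f X| = |f X| * (1 + ‖X‖) ^ 8 * wX := by
        rw [hwX, mul_assoc, mul_inv_cancel₀ (by positivity), mul_one]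
      rw [h1]
      calc |f X| * (1 + ‖X‖) ^ 8 * wX * E⁻¹ ^ 9 ≤ CE * (a * E) ^ 9 * wX * E⁻¹ ^ 9 := by gcongr
        _ = CE * a ^ 9 * wX * (E * E⁻¹) ^ 9 := by ring
        _ = CE * a ^ 9 * wX := by rw [mul_inv_cancel₀ hE0.ne', one_pow, mul_one]
    calc |f X| * |g Y| * D⁻¹ ^ 9 ≤ |f X| * |g Y| * E⁻¹ ^ 9 :=
          mul_le_mul_of_nonneg_left hDE (by positivity)
      _ = (|f X| * E⁻¹ ^ 9) * |g Y| := by ring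
      _ ≤ (CE * a ^ 9 * wX) * (Cg * wY) := mul_le_mul hfE hgY (abs_nonneg _) (by positivity)
      _ = CE * Cg * a ^ 9 * wX * wY := by ring
      _ ≤ (CE * Cg + Cf * Cg) * a ^ 9 * wX * wY := by
          gcongr; linarith [mul_nonneg hCf0 hCg0]

/-- **Flat pair sums (stub S-c of the `Sketch` line).** For disjointly supported Schwartz
`f, g` on `ℝ⁴`, the lattice pair sum `∑_{x ≠ y ∈ {-L..L}⁴} |f(ax)| |g(ay)| D(x,y)⁻⁹`, with `D` the
distance on the torus of side `2L+1`, is `O(a)` uniformly in `0 < a ≤ 1 ≤ a²L`: the pointwise bound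
`pair_term_le` times the lattice Riemann sum `∑_x (1 + ‖ax‖)⁻⁸ = O(a⁻⁴)` squared. [folklore] -/
theorem stub_flatPairSum (f g : SchwartzMap (EuclideanSpace ℝ (Fin 4)) ℝ) (hfg : Disjoint (tsupport f) (tsupport g)) : ∃ C : ℝ, ∀ (a : ℝ), 0 < a → a ≤ 1 → ∀ (L : ℕ), (1 : ℝ) ≤ a ^ 2 * L → ∑ x ∈ box 4 L, ∑ y ∈ (box 4 L).erase x, |f (a • siteToE x)| * |g (a • siteToE y)| * (Real.sqrt (∑ μ, ((((Torus.proj (2 * L + 1) x - Torus.proj (2 * L + 1) y) μ).valMinAbs : ℤ) : ℝ) ^ 2))⁻¹ ^ 9 ≤ C * a := by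
  obtain ⟨K, hK0, hK⟩ := pair_term_le f g hfg
  refine ⟨K * 256 ^ 2, ?_⟩
  intro a ha ha1 L hL
  set w : Site 4 → ℝ := fun x => ((1 + ‖a • siteToE x‖) ^ 8)⁻¹ with hw
  have hS : ∑ x ∈ box 4 L, w x ≤ 256 * a⁻¹ ^ 4 := sum_box_weight_le ha ha1 L
  have hS0 : 0 ≤ ∑ x ∈ box 4 L, w x := Finset.sum_nonneg fun x _ => by positivity
  have hprod : ∑ x ∈ box 4 L, ∑ y ∈ box 4 L, K * a ^ 9 * w x * w y =
      K * a ^ 9 * ((∑ x ∈ box 4 L, w x) * (∑ y ∈ box 4 L, w y)) := by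
    rw [Finset.sum_mul_sum, Finset.mul_sum]
    refine Finset.sum_congr rfl fun x _ => ?_
    rw [Finset.mul_sum]
    refine Finset.sum_congr rfl fun y _ => ?_
    ring
  calc ∑ x ∈ box 4 L, ∑ y ∈ (box 4 L).erase x, |f (a • siteToE x)| * |g (a • siteToE y)| *
          (Real.sqrt (∑ μ, ((((Torus.proj (2 * L + 1) x - Torus.proj (2 * L + 1) y) μ).valMinAbs
            : ℤ) : ℝ) ^ 2))⁻¹ ^ 9
      ≤ ∑ x ∈ box 4 L, ∑ y ∈ (box 4 L).erase x, K * a ^ 9 * w x * w y := by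
        apply Finset.sum_le_sum
        intro x _
        apply Finset.sum_le_sum
        intro y hy
        exact hK a ha ha1 L hL x y (Finset.mem_erase.mp hy).1.symm
    _ ≤ ∑ x ∈ box 4 L, ∑ y ∈ box 4 L, K * a ^ 9 * w x * w y := by
        apply Finset.sum_le_sum
        intro x _
        exact Finset.sum_le_sum_of_subset_of_nonneg (Finset.erase_subset _ _)
          fun y _ _ => by positivity
    _ = K * a ^ 9 * ((∑ x ∈ box 4 L, w x) * (∑ y ∈ box 4 L, w y)) := hprod
    _ ≤ K * a ^ 9 * ((256 * a⁻¹ ^ 4) * (256 * a⁻¹ ^ 4)) :=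
        mul_le_mul_of_nonneg_left (mul_le_mul hS hS hS0 (by positivity)) (by positivity)
    _ = K * 256 ^ 2 * a := by field_simp

end Summit.QuantumFields.YangMills.Theorems.SelfNormalisedSkewness.Negative

end
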